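import Literature.NumberTheory.LFunctions.GaussianHeckeMeanValue
import Literature.NumberTheory.LFunctions.DirichletPolynomialGallagher
import Literature.NumberTheory.LFunctions.DirichletPolynomialDiscreteMeanValue
import HarnessLib

/-!
# The hybrid (discrete-in-`t`) mean value theorem for twisted Hecke polynomials of `ℤ[i]`

Topic `Literature/NumberTheory/LFunctions`.  Everything in this file is PROVED; no definitions, no
named facts.  For coefficients `a_v` on `ℤ[i]* ∩ {N(v) ≤ N}` consider the TWISTED Hecke polynomials

  `F_m(t) = ∑_{v ∈ ℤ[i]*, N(v) ≤ N} a_v λ^m(v) N(v)^{-it}`     (`m ∈ ℤ`, `t ∈ ℝ`),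

the Dirichlet polynomials (in `t`) of the family of Hecke characters `λ^m`.  From the mean value
theorem in `m` (the named fact `JarviniemiTeravainen2024_heckeMVT`, taken as the hypothesis `hMVT`
— it is DISCHARGED in the tree, `JarviniemiTeravainen2024_heckeMVT_holds` in
`GaussianHeckeMeanValueLargeSieveProofs.lean`, which consumers supply; keeping it a hypothesis here
keeps this file import-light: `∑_{|m| ≤ K} |∑ b_v λ^m(v)|² ≤ C₀ (N + K) ∑'_{n primitive} |b_n'|²`,
Harman 2007 Lemma 11.1) and Gallagher's first lemma in `t`
(`Literature.NumberTheory.LFunctions.Gallagher.gallagher_first_lemma`, Huxley Ch. 18 (18.17)) we prove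
the **hybrid large sieve for the family `{λ^m(·) N(·)^{-it}}`** (the `ℚ(i)`-analogue of the
discrete mean value theorem for Dirichlet polynomials, Montgomery 1969 / Huxley (18.29), in the
form needed for the class-I zeros of the zero-detection method, Huxley Ch. 23):

* `exists_sum_sum_norm_sq_twist_le` — there is an absolute `C` such that for `N, K ≥ 1`, `δ > 0`,
  `X₁ ≤ X₂`, and, for each `|m| ≤ K`, a finite set `𝒯_m ⊂ [X₁ + δ/2, X₂ − δ/2]` of pairwise
  `δ`-spaced reals,
  `∑_{|m| ≤ K} ∑_{t ∈ 𝒯_m} |F_m(t)|² ≤ C (N + K) (X₂ − X₁) (δ⁻¹ + log N) · W(a)`,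
  `W(a) = ∑_v |a_v|² g(v) √(N/N(v))` (`g(v) = gcd(re v, im v)`; the ray-sum majorant of
  `GaussianInt.sum_norm_rayCoeff_sq_le`, which for coefficients on a dyadic shell `N/2 < N(v) ≤ N`
  is `≤ √2 ∑_v g(v) |a_v|²`).

Steps: `sum_norm_sq_heckeSum_twist_le` (the `m`-MVT at a fixed twist `t`, the twist being absorbed
into the coefficients: `|b_n'| ≤ ∑_{ray} |a_v|`), `integral`/`sum` interchange, Gallagher's lemma for
each `m`, and Cauchy–Schwarz over `m` (`sum_sqrt_mul_sqrt_le`).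

## References

* M. N. Huxley, *The Distribution of Prime Numbers*, OUP 1972, Ch. 18 (18.17), (18.29); Ch. 19
  (the hybrid sieve); Ch. 23 (23.16). [Huxley1972]
* G. Harman, *Prime-Detecting Sieves*, Princeton UP 2007, Lemma 11.1. [Harman2007]
* H. L. Montgomery, *Topics in Multiplicative Number Theory*, LNM 227 (1971), Thm. 7.3 / Ch. 12.
  [Montgomery1971]
-/

noncomputable section

open Complex Finset Real MeasureTheory intervalIntegral
open scoped ComplexConjugate

namespace Literature.NumberTheory.LFunctions.GaussianInt

/-! ### Norms as natural numbers; the twist `N(v)^{-it}` -/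

/-- For `v ∈ ℤ[i]*`, `N(v) ≥ 1`, so `N(v)` as a natural number is nonzero. [folklore] -/
theorem natAbs_norm_ne_zero {v : GaussianInt} (hv : v ∈ firstQuadrant) : v.norm.natAbs ≠ 0 := by
  have h := norm_pos_of_mem_firstQuadrant hv
  omega

/-- `|N(v)^{-it}| = 1` for `v ∈ ℤ[i]*`. [folklore] -/
theorem norm_twist {v : GaussianInt} (hv : v ∈ firstQuadrant) (t : ℝ) :
    ‖((v.norm.natAbs : ℕ) : ℂ) ^ (-((t : ℂ) * I))‖ = 1 := by
  rw [Complex.norm_natCast_cpow_of_pos (Nat.pos_of_ne_zero (natAbs_norm_ne_zero hv))]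
  simp

/-- `0 ≤ log N(v) ≤ log N` for `v ∈ ℤ[i]*`, `N(v) ≤ N`. [folklore] -/
theorem log_natAbs_norm_mem {N : ℝ} {v : GaussianInt} (hv : v ∈ normLEStar N) :
    0 ≤ Real.log (v.norm.natAbs : ℕ) ∧ Real.log (v.norm.natAbs : ℕ) ≤ Real.log N := by
  rw [mem_normLEStar] at hv
  have h1 : (1 : ℝ) ≤ (v.norm.natAbs : ℕ) := by
    exact_mod_cast Nat.one_le_iff_ne_zero.2 (natAbs_norm_ne_zero hv.2)
  refine ⟨Real.log_nonneg h1, Real.log_le_log (by linarith) ?_⟩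
  rw [GaussianInt.natCast_natAbs_norm]; exact hv.1

/-! ### The `m`-mean value theorem at a fixed twist -/

/-- Ray sums are dominated by the ray sums of the absolute values: for coefficients `b` with
`|b_v| ≤ c_v` (`c_v ≥ 0` real), `|b_n'| ≤ c_n'`. [folklore] -/
theorem norm_rayCoeff_le (N : ℝ) {b : GaussianInt → ℂ} {c : GaussianInt → ℝ}
    (h : ∀ v, ‖b v‖ ≤ c v) (n : GaussianInt) :
    ‖rayCoeff N b n‖ ≤ ‖rayCoeff N (fun v ↦ (c v : ℂ)) n‖ := by
  rw [rayCoeff_eq_sum_rayStar, rayCoeff_eq_sum_rayStar]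
  have hc0 : ∀ v, 0 ≤ c v := fun v ↦ (norm_nonneg _).trans (h v)
  have hsum : ∑ v ∈ rayStar N n, ((c v : ℝ) : ℂ) = ((∑ v ∈ rayStar N n, c v : ℝ) : ℂ) := by
    push_cast; rfl
  rw [hsum, Complex.norm_real, Real.norm_of_nonneg (sum_nonneg fun v _ ↦ hc0 v)]
  exact (norm_sum_le _ _).trans (sum_le_sum fun v _ ↦ h v)

/-- **The `m`-MVT at a fixed twist `t`:** there is an absolute `C₀ ≥ 0` with
`∑_{|m| ≤ K} |∑_v a_v N(v)^{-it} λ^m(v)|² ≤ C₀ (N + K) W(a)`, `W(a) = ∑_v |a_v|² g(v) √(N/N(v))`, for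
`N, K ≥ 1` and all `a`, `t` (the twist has modulus `1` and is absorbed into the coefficients of
the fact `hMVT`; then `GaussianInt.sum_norm_rayCoeff_sq_le`).  Relies on: hypothesis `hMVT`
(discharged in the tree: `JarviniemiTeravainen2024_heckeMVT_holds`). [cite: Harman2007, Lemma 11.1] -/
theorem exists_sum_norm_sq_heckeSum_twist_le (hMVT : JarviniemiTeravainen2024_heckeMVT) :
    ∃ C₀ : ℝ, 0 ≤ C₀ ∧ ∀ (N : ℝ) (K : ℕ) (a : GaussianInt → ℂ) (t : ℝ), 1 ≤ N → 1 ≤ K →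
      ∑ m ∈ Icc (-(K : ℤ)) K,
          ‖heckeSum N (fun v ↦ a v * ((v.norm.natAbs : ℕ) : ℂ) ^ (-((t : ℂ) * I))) m‖ ^ 2 ≤
        C₀ * (N + K) * ∑ v ∈ normLEStar N, ‖a v‖ ^ 2 * (content v * Real.sqrt (N / v.norm)) := by
  obtain ⟨C, hC⟩ := hMVT
  refine ⟨max C 0, le_max_right _ _, fun N K a t hN hK ↦ ?_⟩
  classical
  set b : GaussianInt → ℂ := fun v ↦ a v * ((v.norm.natAbs : ℕ) : ℂ) ^ (-((t : ℂ) * I)) with hb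
  have h1 := hC N K b hN hK
  set c : GaussianInt → ℝ := fun v ↦ ‖a v‖ with hc
  have hbc : ∀ v, ‖b v‖ ≤ c v := by
    intro v
    rw [hb, hc]
    dsimp only
    rw [norm_mul]
    rcases Nat.eq_zero_or_pos v.norm.natAbs with h0 | hpos
    · rw [h0]
      rcases eq_or_ne (-((t : ℂ) * I)) 0 with ht | ht
      · rw [ht, cpow_zero, norm_one, mul_one]
      · rw [Nat.cast_zero, Complex.zero_cpow ht, norm_zero, mul_zero]; exact norm_nonneg _
    · rw [Complex.norm_natCast_cpow_of_pos hpos]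
      simp
  have h2 : ∑ n ∈ (normLEStar N).filter IsPrimitive, ‖rayCoeff N b n‖ ^ 2 ≤
      ∑ n ∈ (normLEStar N).filter IsPrimitive, ‖rayCoeff N (fun v ↦ (c v : ℂ)) n‖ ^ 2 :=
    sum_le_sum fun n _ ↦ pow_le_pow_left₀ (norm_nonneg _) (norm_rayCoeff_le N hbc n) 2
  have h3 := sum_norm_rayCoeff_sq_le N (fun v ↦ (c v : ℂ))
  have h3' : ∑ v ∈ normLEStar N, ‖((c v : ℝ) : ℂ)‖ ^ 2 * (content v * Real.sqrt (N / v.norm)) =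
      ∑ v ∈ normLEStar N, ‖a v‖ ^ 2 * (content v * Real.sqrt (N / v.norm)) := by
    refine sum_congr rfl fun v _ ↦ ?_
    rw [hc, Complex.norm_real, Real.norm_of_nonneg (norm_nonneg _)]
  rw [h3'] at h3
  have hS : 0 ≤ ∑ n ∈ (normLEStar N).filter IsPrimitive, ‖rayCoeff N b n‖ ^ 2 :=
    sum_nonneg fun _ _ ↦ by positivity
  have hNK : (0 : ℝ) ≤ N + K := by positivity
  calc ∑ m ∈ Icc (-(K : ℤ)) K, ‖heckeSum N b m‖ ^ 2
      ≤ C * (N + K) * ∑ n ∈ (normLEStar N).filter IsPrimitive, ‖rayCoeff N b n‖ ^ 2 := h1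
    _ ≤ max C 0 * (N + K) * ∑ n ∈ (normLEStar N).filter IsPrimitive, ‖rayCoeff N b n‖ ^ 2 := by
        gcongr; exact le_max_left _ _
    _ ≤ max C 0 * (N + K) * ∑ v ∈ normLEStar N, ‖a v‖ ^ 2 * (content v * Real.sqrt (N / v.norm)) :=
        mul_le_mul_of_nonneg_left (h2.trans h3) (mul_nonneg (le_max_right _ _) hNK)

/-! ### Gallagher's lemma in `t`, summed over `m` -/

/-- The twisted Hecke polynomial `F_m(y) = ∑_v a_v N(v)^{-iy} λ^m(v)` is differentiable in `y`,
with derivative the twisted Hecke polynomial of the coefficients `a_v · (−i log N(v))`. [folklore] -/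
theorem hasDerivAt_heckeSum_twist (N : ℝ) (a : GaussianInt → ℂ) (m : ℤ) (t : ℝ) :
    HasDerivAt
      (fun y : ℝ ↦ heckeSum N (fun v ↦ a v * ((v.norm.natAbs : ℕ) : ℂ) ^ (-((y : ℂ) * I))) m)
      (heckeSum N (fun v ↦ (a v * (-(Real.log (v.norm.natAbs : ℕ) : ℂ) * I)) *
        ((v.norm.natAbs : ℕ) : ℂ) ^ (-((t : ℂ) * I))) m) t := by
  unfold heckeSum
  refine HasDerivAt.fun_sum fun v hv ↦ ?_
  have h0 : v.norm.natAbs ≠ 0 := natAbs_norm_ne_zero (mem_normLEStar.1 hv).2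
  have h := ((hasDerivAt_natCast_cpow_neg_mul_I h0 t).const_mul (a v)).mul_const (angularCharZ m v)
  refine h.congr_deriv ?_
  ring

/-- The twisted Hecke polynomial is continuous in the twist. [folklore] -/
theorem continuous_heckeSum_twist (N : ℝ) (a : GaussianInt → ℂ) (m : ℤ) :
    Continuous fun y : ℝ ↦ heckeSum N (fun v ↦ a v * ((v.norm.natAbs : ℕ) : ℂ) ^ (-((y : ℂ) * I))) m :=
  continuous_iff_continuousAt.2 fun y ↦ (hasDerivAt_heckeSum_twist N a m y).continuousAt

/-- The ray-sum majorant of the differentiated coefficients: `W(a · (−i log N(·))) ≤ (log N)² W(a)`.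
[folklore] -/
theorem weight_deriv_le {N : ℝ} (a : GaussianInt → ℂ) :
    ∑ v ∈ normLEStar N, ‖a v * (-(Real.log (v.norm.natAbs : ℕ) : ℂ) * I)‖ ^ 2 *
        (content v * Real.sqrt (N / v.norm)) ≤
      Real.log N ^ 2 * ∑ v ∈ normLEStar N, ‖a v‖ ^ 2 * (content v * Real.sqrt (N / v.norm)) := by
  rw [mul_sum]
  refine sum_le_sum fun v hv ↦ ?_
  obtain ⟨hl0, hlN⟩ := log_natAbs_norm_mem hv
  have hn : ‖a v * (-(Real.log (v.norm.natAbs : ℕ) : ℂ) * I)‖ = ‖a v‖ * Real.log (v.norm.natAbs : ℕ) := by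
    rw [norm_mul, norm_mul, norm_neg, Complex.norm_real, Complex.norm_I, mul_one,
      Real.norm_of_nonneg hl0]
  rw [hn, mul_pow]
  have hw : 0 ≤ ‖a v‖ ^ 2 * (content v * Real.sqrt (N / v.norm)) := by positivity
  calc ‖a v‖ ^ 2 * Real.log (v.norm.natAbs : ℕ) ^ 2 * (content v * Real.sqrt (N / v.norm))
      = Real.log (v.norm.natAbs : ℕ) ^ 2 * (‖a v‖ ^ 2 * (content v * Real.sqrt (N / v.norm))) := by ring
    _ ≤ Real.log N ^ 2 * (‖a v‖ ^ 2 * (content v * Real.sqrt (N / v.norm))) :=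
        mul_le_mul_of_nonneg_right (pow_le_pow_left₀ hl0 hlN 2) hw

/-- Cauchy–Schwarz in the form `∑ √x_i √y_i ≤ √(∑ x_i) √(∑ y_i)` for nonnegative reals. [folklore] -/
theorem sum_sqrt_mul_sqrt_le {ι : Type*} (s : Finset ι) {x y : ι → ℝ} (hx : ∀ i, 0 ≤ x i)
    (hy : ∀ i, 0 ≤ y i) :
    ∑ i ∈ s, Real.sqrt (x i) * Real.sqrt (y i) ≤ Real.sqrt (∑ i ∈ s, x i) * Real.sqrt (∑ i ∈ s, y i) := by
  have h := sum_mul_sq_le_sq_mul_sq s (fun i ↦ Real.sqrt (x i)) (fun i ↦ Real.sqrt (y i))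
  simp only [Real.sq_sqrt (hx _), Real.sq_sqrt (hy _)] at h
  have h0 : 0 ≤ ∑ i ∈ s, Real.sqrt (x i) * Real.sqrt (y i) := sum_nonneg fun _ _ ↦ by positivity
  rw [← Real.sqrt_mul (sum_nonneg fun i _ ↦ hx i), ← Real.sqrt_sq h0]
  exact Real.sqrt_le_sqrt h

/-- Integrating a pointwise bound for a finite sum of continuous functions:
`∑_m ∫_{X₁}^{X₂} g_m ≤ (X₂ − X₁) B` if `∑_m g_m(y) ≤ B` for all `y`. [folklore] -/
theorem sum_integral_le_of_forall_sum_le {M : Finset ℤ} {g : ℤ → ℝ → ℝ} (hgc : ∀ m, Continuous (g m))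
    {B X₁ X₂ : ℝ} (h12 : X₁ ≤ X₂) (hpt : ∀ y : ℝ, ∑ m ∈ M, g m y ≤ B) :
    ∑ m ∈ M, ∫ y in X₁..X₂, g m y ≤ (X₂ - X₁) * B := by
  have hint : ∀ m ∈ M, IntervalIntegrable (g m) volume X₁ X₂ := fun m _ ↦
    (hgc m).intervalIntegrable _ _
  rw [← intervalIntegral.integral_finsetSum hint]
  have hc : Continuous fun y ↦ ∑ m ∈ M, g m y := continuous_finsetSum M fun m _ ↦ hgc m
  calc ∫ y in X₁..X₂, ∑ m ∈ M, g m y ≤ ∫ _ in X₁..X₂, B :=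
        intervalIntegral.integral_mono_on h12 (hc.intervalIntegrable _ _) intervalIntegrable_const
          (fun y _ ↦ hpt y)
    _ = (X₂ - X₁) * B := by rw [intervalIntegral.integral_const, smul_eq_mul]

/-- **The hybrid mean value theorem for twisted Hecke polynomials** (discrete in `t`, summed over
the family `|m| ≤ K`; Gallagher's first lemma in `t` + the `m`-MVT at each fixed twist):
there is an absolute `C ≥ 0` such that for `N, K ≥ 1`, `δ > 0`, `X₁ ≤ X₂`, and finite sets
`𝒯_m ⊂ [X₁ + δ/2, X₂ − δ/2]` of pairwise `δ`-spaced reals (`|m| ≤ K`),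
`∑_{|m| ≤ K} ∑_{t ∈ 𝒯_m} |∑_v a_v N(v)^{-it} λ^m(v)|² ≤ C (N + K)(X₂ − X₁)(δ⁻¹ + log N) · W(a)`,
`W(a) = ∑_v |a_v|² g(v) √(N/N(v))`.  Relies on: hypothesis `hMVT` (discharged in the tree:
`JarviniemiTeravainen2024_heckeMVT_holds`). [cite: Huxley1972, Ch. 18, (18.29)] -/
theorem exists_sum_sum_norm_sq_twist_le (hMVT : JarviniemiTeravainen2024_heckeMVT) :
    ∃ C : ℝ, 0 ≤ C ∧ ∀ (N : ℝ) (K : ℕ) (a : GaussianInt → ℂ) (𝒯 : ℤ → Finset ℝ) (δ X₁ X₂ : ℝ),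
      1 ≤ N → 1 ≤ K → 0 < δ → X₁ ≤ X₂ →
      (∀ m, ∀ t ∈ 𝒯 m, X₁ + δ / 2 ≤ t ∧ t ≤ X₂ - δ / 2) →
      (∀ m, ∀ t ∈ 𝒯 m, ∀ t' ∈ 𝒯 m, t ≠ t' → δ ≤ |t - t'|) →
      ∑ m ∈ Icc (-(K : ℤ)) K, ∑ t ∈ 𝒯 m,
          ‖heckeSum N (fun v ↦ a v * ((v.norm.natAbs : ℕ) : ℂ) ^ (-((t : ℂ) * I))) m‖ ^ 2 ≤
        C * (N + K) * (X₂ - X₁) * (δ⁻¹ + Real.log N) *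
          ∑ v ∈ normLEStar N, ‖a v‖ ^ 2 * (content v * Real.sqrt (N / v.norm)) := by
  obtain ⟨C₀, hC₀, hMVT⟩ := exists_sum_norm_sq_heckeSum_twist_le hMVT
  refine ⟨C₀, hC₀, fun N K a 𝒯 δ X₁ X₂ hN hK hδ h12 hmem hsep ↦ ?_⟩
  classical
  set M := Icc (-(K : ℤ)) K with hM
  set W : ℝ := ∑ v ∈ normLEStar N, ‖a v‖ ^ 2 * (content v * Real.sqrt (N / v.norm)) with hW
  set L : ℝ := Real.log N with hL
  have hL0 : 0 ≤ L := Real.log_nonneg hN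
  have hW0 : 0 ≤ W := sum_nonneg fun _ _ ↦ by positivity
  have hNK : (0 : ℝ) ≤ N + K := by positivity
  -- the functions and their derivatives
  set f : ℤ → ℝ → ℂ := fun m y ↦
    heckeSum N (fun v ↦ a v * ((v.norm.natAbs : ℕ) : ℂ) ^ (-((y : ℂ) * I))) m with hf
  set a' : GaussianInt → ℂ := fun v ↦ a v * (-(Real.log (v.norm.natAbs : ℕ) : ℂ) * I) with ha'
  set f' : ℤ → ℝ → ℂ := fun m y ↦
    heckeSum N (fun v ↦ a' v * ((v.norm.natAbs : ℕ) : ℂ) ^ (-((y : ℂ) * I))) m with hf'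
  have hderiv : ∀ m y, HasDerivAt (f m) (f' m y) y := fun m y ↦ hasDerivAt_heckeSum_twist N a m y
  have hfc : ∀ m, Continuous (f m) := fun m ↦ continuous_heckeSum_twist N a m
  have hf'c : ∀ m, Continuous (f' m) := fun m ↦ continuous_heckeSum_twist N a' m
  -- Gallagher for each `m`
  set I1 : ℤ → ℝ := fun m ↦ ∫ y in X₁..X₂, ‖f m y‖ ^ 2 with hI1
  set I2 : ℤ → ℝ := fun m ↦ ∫ y in X₁..X₂, ‖f' m y‖ ^ 2 with hI2
  have hG : ∀ m, ∑ t ∈ 𝒯 m, ‖f m t‖ ^ 2 ≤ δ⁻¹ * I1 m + Real.sqrt (I1 m) * Real.sqrt (I2 m) :=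
    fun m ↦ Gallagher.gallagher_first_lemma (hderiv m) (hf'c m) hδ h12 (𝒯 m) (hmem m) (hsep m)
  have hI10 : ∀ m, 0 ≤ I1 m := fun m ↦
    intervalIntegral.integral_nonneg h12 fun y _ ↦ by positivity
  have hI20 : ∀ m, 0 ≤ I2 m := fun m ↦
    intervalIntegral.integral_nonneg h12 fun y _ ↦ by positivity
  -- the integrated `m`-MVT for `f` and `f'`
  have hInt : ∀ (b : GaussianInt → ℂ),
      ∑ m ∈ M, ∫ y in X₁..X₂,
          ‖heckeSum N (fun v ↦ b v * ((v.norm.natAbs : ℕ) : ℂ) ^ (-((y : ℂ) * I))) m‖ ^ 2 ≤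
        (X₂ - X₁) * (C₀ * (N + K) *
            ∑ v ∈ normLEStar N, ‖b v‖ ^ 2 * (content v * Real.sqrt (N / v.norm))) :=
    fun b ↦ sum_integral_le_of_forall_sum_le
      (g := fun m y ↦ ‖heckeSum N (fun v ↦ b v * ((v.norm.natAbs : ℕ) : ℂ) ^ (-((y : ℂ) * I))) m‖ ^ 2)
      (fun m ↦ (continuous_norm.comp (continuous_heckeSum_twist N b m)).pow 2) h12
      (fun y ↦ hMVT N K b y hN hK)
  set E : ℝ := (X₂ - X₁) * (C₀ * (N + K) * W) with hE
  have h120 : 0 ≤ X₂ - X₁ := by linarith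
  have hE0 : 0 ≤ E := mul_nonneg h120 (mul_nonneg (mul_nonneg hC₀ hNK) hW0)
  have hI1 : ∑ m ∈ M, I1 m ≤ E := hInt a
  have hI2 : ∑ m ∈ M, I2 m ≤ L ^ 2 * E := by
    refine (hInt a').trans ?_
    have h := weight_deriv_le (N := N) a
    have h0 : 0 ≤ (X₂ - X₁) * (C₀ * (N + K)) := mul_nonneg h120 (mul_nonneg hC₀ hNK)
    calc (X₂ - X₁) * (C₀ * (N + K) *
          ∑ v ∈ normLEStar N, ‖a' v‖ ^ 2 * (content v * Real.sqrt (N / v.norm)))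
        = (X₂ - X₁) * (C₀ * (N + K)) *
          ∑ v ∈ normLEStar N, ‖a' v‖ ^ 2 * (content v * Real.sqrt (N / v.norm)) := by ring
      _ ≤ (X₂ - X₁) * (C₀ * (N + K)) * (L ^ 2 * W) := mul_le_mul_of_nonneg_left h h0
      _ = L ^ 2 * E := by rw [hE]; ring
  -- Cauchy–Schwarz over `m` and assembly
  have hCS := sum_sqrt_mul_sqrt_le M hI10 hI20
  have hsq : Real.sqrt (∑ m ∈ M, I1 m) * Real.sqrt (∑ m ∈ M, I2 m) ≤ Real.sqrt E * Real.sqrt (L ^ 2 * E) := by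
    gcongr
  have hLE : Real.sqrt E * Real.sqrt (L ^ 2 * E) = L * E := by
    rw [Real.sqrt_mul (sq_nonneg L), Real.sqrt_sq hL0]
    calc Real.sqrt E * (L * Real.sqrt E) = L * (Real.sqrt E * Real.sqrt E) := by ring
      _ = L * E := by rw [Real.mul_self_sqrt hE0]
  calc ∑ m ∈ M, ∑ t ∈ 𝒯 m, ‖f m t‖ ^ 2
      ≤ ∑ m ∈ M, (δ⁻¹ * I1 m + Real.sqrt (I1 m) * Real.sqrt (I2 m)) := sum_le_sum fun m _ ↦ hG m
    _ = δ⁻¹ * ∑ m ∈ M, I1 m + ∑ m ∈ M, Real.sqrt (I1 m) * Real.sqrt (I2 m) := by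
        rw [sum_add_distrib, mul_sum]
    _ ≤ δ⁻¹ * E + Real.sqrt E * Real.sqrt (L ^ 2 * E) := by
        have hδ0 : 0 ≤ δ⁻¹ := by positivity
        exact add_le_add (mul_le_mul_of_nonneg_left hI1 hδ0) (hCS.trans hsq)
    _ = E * (δ⁻¹ + L) := by rw [hLE]; ring
    _ = C₀ * (N + K) * (X₂ - X₁) * (δ⁻¹ + L) * W := by rw [hE]; ring

end Literature.NumberTheory.LFunctions.GaussianInt
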